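import Summits.HodgeConjecture.HodgeConjecture.Theorems.Ring2WeilCoverageNormClassEq
import Summits.HodgeConjecture.HodgeConjecture.Theorems.Ring2WeilNormObstructionDescentCensus
import HarnessLib

/-!
# Weil-type family coverage — THEOREM S6 (the PRODUCT-WINDOW LAW) and its `C₃ × F₂₀` instances: curve-carried Weil-type sixfolds on
`W6.3.5 = (3, ℚ(√-3), [5])` (pub-hsemireg's row R2; ring2-b02's `G₆₀` families) and rigid fourfolds on `W4.3.5`

research route conditional on HC_CM; not a corollary; Q11.4-sentence-2 already refuted in dim ≥ 3.

Ring 2, WEIL-TYPE FAMILY-COVERAGE CENSUS (`HOME/WEIL-FAMILY-COVERAGE.md` `## b04`, block b04.13, owner ring2-b04, gen 49).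
THE PRODUCT WINDOW: `G = C_k × G₂` acting on a curve `C̃`, `C_k = ⟨c⟩` (`k = 3`: `K = ℚ(√-3)`; `k = 4`: `K = ℚ(i)`) carrying the
field, `G₂` a 2-transitive permutation group of degree `n` with point stabiliser `H` (`|G₂| = n·|H|`), `ρ = π − 1` its rational
irreducible character of degree `n − 1`; the `(λ⊗ρ)`-isotypic piece `P` of `J(C̃)` is `~ B^{n-1}` and the HIDDEN FACTOR
`B = (H¹(P,ℚ))^{H}` with the RESTRICTED polarisation is an abelian variety with `K`-action whose discriminant class THEOREM S6 computes:
`[a_B] = [γ_k |G₂|]^{r₁} · [γ_k |H|]^{r₁ + m}` (`γ₃ = 2`, `γ₄ = 1`; `r₁ = dim_K H¹(C̃/G₂)_λ`, `m = dim_K B`), i.e. for `B` of WEIL TYPE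
(`m` even) `[a_B] = [n]^{r₁}` — proved in the census block from the orthogonal decomposition `H¹(C̃)^{H}_λ = H¹(C̃)^{G₂}_λ ⊕ B`,
pull-back scaling and the `2`-adic valuation of cyclic pieces.

* §1 the law's ARITHMETIC SKELETON in `ℚˣ/Nm(K_dˣ)` (any `d`): `[(2nh)^r (2h)^{r+2k}] = [n^r]`, `[n^{2j}] = [1]`, `[n^{2j+1}] = [n]`, and the
  `C₃ × F₂₀` corollary: for `r₁` odd the sixfold factor is on the NON-split row `[-5] ≠ split` (ring2-b02's `negFive_ne_split_three_three`).
* §2 literal classes of the `C₃ × F₂₀` data of this window (engine `prodwin.py` = ring2-b02's `qcover.py` + the product-window block,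
  exact; kit jobs j194911/j194914 + local runs): the four one-parameter FAMILIES of `C₃ × F₂₀`-curves of genus 36/39 whose factor is a
  `(3,3)` sixfold on `W6.3.5` — these are ring2-b02's `G₆₀ = F₂₀ × C₃` families of census b02.19 P.S. 3 (found there first, by THEOREM U's
  LU law, `det H ≡ -5`; Hodge-generic by b02.20 LEMMA AS), recomputed here independently (×3 with ring2-b05's b05.25) — and the rigid
  fourfolds of genus 21/21/24 on `W4.3.5`, each with the CELL IDENTIFICATION `[det H] = [-5]` resp. `[5]` (the census row keys).  The
  `C₆ × F₂₀`, `C₃ × A₅` and `C₄ × S₃` (row `W6.1.3`, key `[-3]`) data are in part B (`Ring2WeilCoverageProductWindowB`), the eightfold /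
  tenfold / control / `C₄ × AGL(1,7)` (`W6.1.7`) / sharp-test / `F₂₁ × S₃` data in part C (`Ring2WeilCoverageProductWindowC`).

No `def`, no named fact, no `sorry`; nothing here is a statement about Hodge classes; `HC_CM` is used nowhere.
References: [cite: vanGeemen1994HodgeAV, (5.4.1), Lemma 5.2]; [cite: Serre1973, Ch. III §1].
-/

set_option linter.dupNamespace false

open Literature.AlgebraicGeometry.Motives
open Literature.AlgebraicGeometry.VanGeemen1994
open Summit.HodgeConjecture.HodgeConjecture.Ring2.Hypotheses

namespace Summit.HodgeConjecture.HodgeConjecture.Ring2.WeilCoverage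

/-! ### §1 THEOREM S6's arithmetic skeleton -/

/-- **THEOREM S6, arithmetic form.** In `ℚˣ/Nm(K_dˣ)` (any `d`): `[(2·n·h)^r · (2·h)^{r+2k}] = [n^r]` — the product-window law
`[a_B] = [γ|G₂|]^{r₁}[γ|H|]^{r₁+m}` with `|G₂| = n·h`, `|H| = h`, `γ = 2`, `m = 2k` EVEN (Weil type) collapses to `[n]^{r₁}`, because
`(2nh)^r (2h)^{r+2k} · n^r = (2^{r+k} n^r h^{r+k})²` is a square, hence a norm.
research route conditional on HC_CM; not a corollary; Q11.4-sentence-2 already refuted in dim ≥ 3. [cite: vanGeemen1994HodgeAV, Lemma 5.2 (3)] -/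
theorem productWindow_mk_eq_mk_pow (d n h r k : ℕ) (hn : (n : ℚ) ≠ 0) (hh : (h : ℚ) ≠ 0) :
    (QuotientGroup.mk (Units.mk0 ((2 * (n : ℚ) * h) ^ r * (2 * (h : ℚ)) ^ (r + 2 * k))
        (mul_ne_zero (pow_ne_zero _ (by positivity)) (pow_ne_zero _ (by positivity)))) : weilNormResidueGroup d) =
      QuotientGroup.mk (Units.mk0 ((n : ℚ) ^ r) (pow_ne_zero _ hn)) :=
  mk_eq_mk_of_mul_mem _ _
    (mem_normUnitsSubgroup_of_sq_add_mul_sq _ ((2 : ℚ) ^ (r + k) * (n : ℚ) ^ r * (h : ℚ) ^ (r + k)) 0 (by ring))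

/-- The same with `γ = 1` (`K = ℚ(i)`, `k = 4`): `[(n·h)^r · h^{r+2k}] = [n^r]` (`(nh)^r h^{r+2k} n^r = (n^r h^{r+k})²`).
research route conditional on HC_CM; not a corollary; Q11.4-sentence-2 already refuted in dim ≥ 3. [cite: vanGeemen1994HodgeAV, Lemma 5.2 (3)] -/
theorem productWindow_mk_eq_mk_pow' (d n h r k : ℕ) (hn : (n : ℚ) ≠ 0) (hh : (h : ℚ) ≠ 0) :
    (QuotientGroup.mk (Units.mk0 (((n : ℚ) * h) ^ r * (h : ℚ) ^ (r + 2 * k))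
        (mul_ne_zero (pow_ne_zero _ (by positivity)) (pow_ne_zero _ (by positivity)))) : weilNormResidueGroup d) =
      QuotientGroup.mk (Units.mk0 ((n : ℚ) ^ r) (pow_ne_zero _ hn)) :=
  mk_eq_mk_of_mul_mem _ _
    (mem_normUnitsSubgroup_of_sq_add_mul_sq _ ((n : ℚ) ^ r * (h : ℚ) ^ (r + k)) 0 (by ring))

/-- Even exponent: `[n^{2j}] = [1]` (a square is a norm).
research route conditional on HC_CM; not a corollary; Q11.4-sentence-2 already refuted in dim ≥ 3. [cite: vanGeemen1994HodgeAV, Lemma 5.2 (3)] -/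
theorem mk_pow_even_eq_mk_one (d n j : ℕ) (hn : (n : ℚ) ≠ 0) :
    (QuotientGroup.mk (Units.mk0 ((n : ℚ) ^ (2 * j)) (pow_ne_zero _ hn)) : weilNormResidueGroup d) =
      QuotientGroup.mk (Units.mk0 (1 : ℚ) one_ne_zero) :=
  mk_eq_mk_of_mul_mem _ _ (mem_normUnitsSubgroup_of_sq_add_mul_sq _ ((n : ℚ) ^ j) 0 (by ring))

/-- Odd exponent: `[n^{2j+1}] = [n]`.
research route conditional on HC_CM; not a corollary; Q11.4-sentence-2 already refuted in dim ≥ 3. [cite: vanGeemen1994HodgeAV, Lemma 5.2 (3)] -/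
theorem mk_pow_odd_eq_mk (d n j : ℕ) (hn : (n : ℚ) ≠ 0) :
    (QuotientGroup.mk (Units.mk0 ((n : ℚ) ^ (2 * j + 1)) (pow_ne_zero _ hn)) : weilNormResidueGroup d) =
      QuotientGroup.mk (Units.mk0 (n : ℚ) hn) :=
  mk_eq_mk_of_mul_mem _ _ (mem_normUnitsSubgroup_of_sq_add_mul_sq _ ((n : ℚ) ^ (j + 1)) 0 (by ring))

/-- **`C₃ × F₂₀` (`n = 5`, `|H| = 4`, `K = ℚ(√-3)`), `r₁ = 2j + 1` ODD, `m = 2k`:** the predicted class `[40^{r₁}·8^{r₁+m}]` of the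
Weil-type factor equals `[5]`, which is NOT a norm class from `ℚ(√-3)` (`5` inert; ring2-b02's `five_not_mem_norm_three`) — so in the
sixfold letter `δ = -a` the factor lies on the NON-split row `(3, ℚ(√-3), [5]) = W6.3.5` (pub-hsemireg's R2). The genus-36/39 families
of §2 have `r₁ = 1`, `m = 6`.
research route conditional on HC_CM; not a corollary; Q11.4-sentence-2 already refuted in dim ≥ 3. [cite: vanGeemen1994HodgeAV, (5.4.1)] -/
theorem productWindow_C3F20_odd_not_mem_norm (j k : ℕ) :
    Units.mk0 ((2 * (5 : ℚ) * 4) ^ (2 * j + 1) * (2 * (4 : ℚ)) ^ (2 * j + 1 + 2 * k))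
        (mul_ne_zero (pow_ne_zero _ (by positivity)) (pow_ne_zero _ (by positivity))) ∉ normUnitsSubgroup ℚ (weilField 3) := by
  intro hmem
  have h1 := productWindow_mk_eq_mk_pow 3 5 4 (2 * j + 1) k (by norm_num) (by norm_num)
  have h2 := mk_pow_odd_eq_mk 3 5 j (by norm_num)
  have h3 : (QuotientGroup.mk (Units.mk0 ((2 * (5 : ℚ) * 4) ^ (2 * j + 1) * (2 * (4 : ℚ)) ^ (2 * j + 1 + 2 * k))
      (mul_ne_zero (pow_ne_zero _ (by positivity)) (pow_ne_zero _ (by positivity)))) : weilNormResidueGroup 3) =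
      QuotientGroup.mk (Units.mk0 (5 : ℚ) (by norm_num)) := by
    have := h1.trans (by exact_mod_cast h2)
    exact_mod_cast this
  have h4 : (QuotientGroup.mk (Units.mk0 (5 : ℚ) (by norm_num)) : weilNormResidueGroup 3) = 1 := by
    rw [← h3, QuotientGroup.eq_one_iff]
    exact hmem
  exact Summit.HodgeConjecture.Ring2WeilNormDescent.five_not_mem_norm_three ((QuotientGroup.eq_one_iff _).1 h4)

/-- **`C₃ × F₂₀`, `r₁ = 2j` EVEN:** the predicted class is the NORM class — the Weil-type factor is on the SPLIT row `W(m).3.1`.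
research route conditional on HC_CM; not a corollary; Q11.4-sentence-2 already refuted in dim ≥ 3. [cite: vanGeemen1994HodgeAV, (5.4.1)] -/
theorem productWindow_C3F20_even_mem_norm (j k : ℕ) :
    Units.mk0 ((2 * (5 : ℚ) * 4) ^ (2 * j) * (2 * (4 : ℚ)) ^ (2 * j + 2 * k))
        (mul_ne_zero (pow_ne_zero _ (by positivity)) (pow_ne_zero _ (by positivity))) ∈ normUnitsSubgroup ℚ (weilField 3) := by
  have h1 := productWindow_mk_eq_mk_pow 3 5 4 (2 * j) k (by norm_num) (by norm_num)
  have h2 := mk_pow_even_eq_mk_one 3 5 j (by norm_num)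
  have h3 : (QuotientGroup.mk (Units.mk0 ((2 * (5 : ℚ) * 4) ^ (2 * j) * (2 * (4 : ℚ)) ^ (2 * j + 2 * k))
      (mul_ne_zero (pow_ne_zero _ (by positivity)) (pow_ne_zero _ (by positivity)))) : weilNormResidueGroup 3) =
      QuotientGroup.mk (Units.mk0 (1 : ℚ) one_ne_zero) := by
    have := h1.trans (by exact_mod_cast h2)
    exact_mod_cast this
  have h5 := QuotientGroup.eq.1 h3
  have h6 : Units.mk0 (1 : ℚ) one_ne_zero = 1 := Units.ext rfl
  rw [h6, mul_one] at h5
  simpa using Subgroup.inv_mem _ h5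

/-- **`C₄ × S₃` (`n = 3`, `|H| = 2`, `K = ℚ(i)`, `γ = 1`), `r₁ = 2j + 1` ODD:** the predicted class `[6^{r₁}·2^{r₁+m}] = [3]` is NOT a norm
class from `ℚ(i)` (ring2-b02's `three_not_mem_norm_one`): the Weil-type factor is on `(3, ℚ(i), [3]) = W6.1.3` (pub-hsemireg's R3) when it
is a sixfold; the genus-21/23/25 families of §2 have `r₁ = 3`, `m = 6`. (This is ring2-b04 gen 48's law `[3]^{r₁}` of census b04.12 P.S. 3.)
research route conditional on HC_CM; not a corollary; Q11.4-sentence-2 already refuted in dim ≥ 3. [cite: vanGeemen1994HodgeAV, (5.4.1)] -/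
theorem productWindow_C4S3_odd_not_mem_norm (j k : ℕ) :
    Units.mk0 (((3 : ℚ) * 2) ^ (2 * j + 1) * (2 : ℚ) ^ (2 * j + 1 + 2 * k))
        (mul_ne_zero (pow_ne_zero _ (by positivity)) (pow_ne_zero _ (by positivity))) ∉ normUnitsSubgroup ℚ (weilField 1) := by
  intro hmem
  have h1 := productWindow_mk_eq_mk_pow' 1 3 2 (2 * j + 1) k (by norm_num) (by norm_num)
  have h2 := mk_pow_odd_eq_mk 1 3 j (by norm_num)
  have h3 : (QuotientGroup.mk (Units.mk0 (((3 : ℚ) * 2) ^ (2 * j + 1) * (2 : ℚ) ^ (2 * j + 1 + 2 * k))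
      (mul_ne_zero (pow_ne_zero _ (by positivity)) (pow_ne_zero _ (by positivity)))) : weilNormResidueGroup 1) =
      QuotientGroup.mk (Units.mk0 (3 : ℚ) (by norm_num)) := by
    have := h1.trans (by exact_mod_cast h2)
    exact_mod_cast this
  have h4 : (QuotientGroup.mk (Units.mk0 (3 : ℚ) (by norm_num)) : weilNormResidueGroup 1) = 1 := by
    rw [← h3, QuotientGroup.eq_one_iff]
    exact hmem
  exact Summit.HodgeConjecture.Ring2WeilNormDescent.three_not_mem_norm_one ((QuotientGroup.eq_one_iff _).1 h4)

/-! ### §2 The first data of the product window: literal classes and cell identifications -/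

/-- `C₃ × F₂₀` (`F₂₀ = AGL(1,5)` on 5 points)-cover `(0; c0:22,c1:22,c1:4A,c1:4B)` (genus 36, Hurwitz dimension 1; engine `prodwin.py`, exact): the HIDDEN FACTOR `B = V^{H₁×Stab(0)}` of the `(λ⊗ρ)`-piece `P ~ B^{4}` (census row of `P`: `W24.3.1`) — an abelian SIXFOLD with `(3,3)` `ℚ(√-3)`-action, WEIL TYPE — has literal `det H|_B = -65536/125`, `a = 65536/125`, `T(a) = [3, 5]`: row `W6.3.5` (NON-split); `r₁ = dim_K H¹(C̃/G₂)_λ = 1`. THEOREM S6 (product-window law, census b04.13 (A)) predicts `T(a_B) = [3, 5]` from `r₁ = 1`, `r_H = 7` — CONFIRMED.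
research route conditional on HC_CM; not a corollary; Q11.4-sentence-2 already refuted in dim ≥ 3. [cite: vanGeemen1994HodgeAV, (5.4.1)] -/
theorem pwC3F20_c022_c122_c14A_c14B_q0_g36_mk_detH_ne_split :
    (QuotientGroup.mk (Units.mk0 (((-65536 : ℚ) / 125)) (by norm_num)) : weilNormResidueGroup 3) ≠
      splitDiscriminantClass 3 3 := by
  have e : Units.mk0 (((-65536 : ℚ) / 125)) (by norm_num) = -(Units.mk0 ((65536 : ℚ) / 125) (by norm_num)) := Units.ext (by norm_num)
  rw [Ne, e, mk_neg_eq_splitDiscriminantClass_iff_of_odd (n := 3) (by decide)]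
  have h := mul_not_mem_normUnitsSubgroup (mem_normUnitsSubgroup_of_sq_add_mul_sq (d := 3) (a := ((65536 : ℚ) / 625)) (by norm_num) ((256 : ℚ) / 25) (0 : ℚ) (by norm_num))
    Summit.HodgeConjecture.Ring2WeilNormDescent.five_not_mem_norm_three
  rw [mk0_mul_mk0] at h
  norm_num at h
  exact h

/-- The same datum, CELL IDENTIFICATION: `[det H|_B] = [-5]` in `ℚˣ/Nm(ℚ(√-3)ˣ)` — the census ROW KEY of `W6.3.5` (`a·5 = ((65536 : ℚ) / 25) = (((256 : ℚ) / 5))² + 3·((0 : ℚ))²`).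
research route conditional on HC_CM; not a corollary; Q11.4-sentence-2 already refuted in dim ≥ 3. [cite: vanGeemen1994HodgeAV, Lemma 5.2 (3)] -/
theorem pwC3F20_c022_c122_c14A_c14B_q0_g36_mk_detH_eq_key :
    (QuotientGroup.mk (Units.mk0 (-(((65536 : ℚ) / 125))) (neg_ne_zero.2 (by norm_num))) : weilNormResidueGroup 3) =
      QuotientGroup.mk (Units.mk0 (-(5 : ℚ)) (neg_ne_zero.2 (by norm_num))) :=
  mk_neg_eq_mk_neg_of_mul_mem (by norm_num) (by norm_num)
    (mem_normUnitsSubgroup_of_sq_add_mul_sq _ ((256 : ℚ) / 5) (0 : ℚ) (by norm_num))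

/-- `C₃ × F₂₀` (`F₂₀ = AGL(1,5)` on 5 points)-cover `(0; c0:22,c1:4A,c1:4A,c1:5)` (genus 39, Hurwitz dimension 1; engine `prodwin.py`, exact): the HIDDEN FACTOR `B = V^{H₁×Stab(0)}` of the `(λ⊗ρ)`-piece `P ~ B^{4}` (census row of `P`: `W24.3.1`) — an abelian SIXFOLD with `(3,3)` `ℚ(√-3)`-action, WEIL TYPE — has literal `det H|_B = -16384/45`, `a = 16384/45`, `T(a) = [3, 5]`: row `W6.3.5` (NON-split); `r₁ = dim_K H¹(C̃/G₂)_λ = 1`. THEOREM S6 (product-window law, census b04.13 (A)) predicts `T(a_B) = [3, 5]` from `r₁ = 1`, `r_H = 7` — CONFIRMED.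
research route conditional on HC_CM; not a corollary; Q11.4-sentence-2 already refuted in dim ≥ 3. [cite: vanGeemen1994HodgeAV, (5.4.1)] -/
theorem pwC3F20_c022_c14A_c14A_c15_q0_g39_mk_detH_ne_split :
    (QuotientGroup.mk (Units.mk0 (((-16384 : ℚ) / 45)) (by norm_num)) : weilNormResidueGroup 3) ≠
      splitDiscriminantClass 3 3 := by
  have e : Units.mk0 (((-16384 : ℚ) / 45)) (by norm_num) = -(Units.mk0 ((16384 : ℚ) / 45) (by norm_num)) := Units.ext (by norm_num)
  rw [Ne, e, mk_neg_eq_splitDiscriminantClass_iff_of_odd (n := 3) (by decide)]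
  have h := mul_not_mem_normUnitsSubgroup (mem_normUnitsSubgroup_of_sq_add_mul_sq (d := 3) (a := ((16384 : ℚ) / 225)) (by norm_num) ((128 : ℚ) / 15) (0 : ℚ) (by norm_num))
    Summit.HodgeConjecture.Ring2WeilNormDescent.five_not_mem_norm_three
  rw [mk0_mul_mk0] at h
  norm_num at h
  exact h

/-- The same datum, CELL IDENTIFICATION: `[det H|_B] = [-5]` in `ℚˣ/Nm(ℚ(√-3)ˣ)` — the census ROW KEY of `W6.3.5` (`a·5 = ((16384 : ℚ) / 9) = (((128 : ℚ) / 3))² + 3·((0 : ℚ))²`).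
research route conditional on HC_CM; not a corollary; Q11.4-sentence-2 already refuted in dim ≥ 3. [cite: vanGeemen1994HodgeAV, Lemma 5.2 (3)] -/
theorem pwC3F20_c022_c14A_c14A_c15_q0_g39_mk_detH_eq_key :
    (QuotientGroup.mk (Units.mk0 (-(((16384 : ℚ) / 45))) (neg_ne_zero.2 (by norm_num))) : weilNormResidueGroup 3) =
      QuotientGroup.mk (Units.mk0 (-(5 : ℚ)) (neg_ne_zero.2 (by norm_num))) :=
  mk_neg_eq_mk_neg_of_mul_mem (by norm_num) (by norm_num)
    (mem_normUnitsSubgroup_of_sq_add_mul_sq _ ((128 : ℚ) / 3) (0 : ℚ) (by norm_num))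

/-- `C₃ × F₂₀` (`F₂₀ = AGL(1,5)` on 5 points)-cover `(0; c0:22,c1:4B,c1:4B,c1:5)` (genus 39, Hurwitz dimension 1; engine `prodwin.py`, exact): the HIDDEN FACTOR `B = V^{H₁×Stab(0)}` of the `(λ⊗ρ)`-piece `P ~ B^{4}` (census row of `P`: `W24.3.1`) — an abelian SIXFOLD with `(3,3)` `ℚ(√-3)`-action, WEIL TYPE — has literal `det H|_B = -65536/5`, `a = 65536/5`, `T(a) = [3, 5]`: row `W6.3.5` (NON-split); `r₁ = dim_K H¹(C̃/G₂)_λ = 1`. THEOREM S6 (product-window law, census b04.13 (A)) predicts `T(a_B) = [3, 5]` from `r₁ = 1`, `r_H = 7` — CONFIRMED.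
research route conditional on HC_CM; not a corollary; Q11.4-sentence-2 already refuted in dim ≥ 3. [cite: vanGeemen1994HodgeAV, (5.4.1)] -/
theorem pwC3F20_c022_c14B_c14B_c15_q0_g39_mk_detH_ne_split :
    (QuotientGroup.mk (Units.mk0 (((-65536 : ℚ) / 5)) (by norm_num)) : weilNormResidueGroup 3) ≠
      splitDiscriminantClass 3 3 := by
  have e : Units.mk0 (((-65536 : ℚ) / 5)) (by norm_num) = -(Units.mk0 ((65536 : ℚ) / 5) (by norm_num)) := Units.ext (by norm_num)
  rw [Ne, e, mk_neg_eq_splitDiscriminantClass_iff_of_odd (n := 3) (by decide)]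
  have h := mul_not_mem_normUnitsSubgroup (mem_normUnitsSubgroup_of_sq_add_mul_sq (d := 3) (a := ((65536 : ℚ) / 25)) (by norm_num) ((256 : ℚ) / 5) (0 : ℚ) (by norm_num))
    Summit.HodgeConjecture.Ring2WeilNormDescent.five_not_mem_norm_three
  rw [mk0_mul_mk0] at h
  norm_num at h
  exact h

/-- The same datum, CELL IDENTIFICATION: `[det H|_B] = [-5]` in `ℚˣ/Nm(ℚ(√-3)ˣ)` — the census ROW KEY of `W6.3.5` (`a·5 = (65536 : ℚ) = ((256 : ℚ))² + 3·((0 : ℚ))²`).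
research route conditional on HC_CM; not a corollary; Q11.4-sentence-2 already refuted in dim ≥ 3. [cite: vanGeemen1994HodgeAV, Lemma 5.2 (3)] -/
theorem pwC3F20_c022_c14B_c14B_c15_q0_g39_mk_detH_eq_key :
    (QuotientGroup.mk (Units.mk0 (-(((65536 : ℚ) / 5))) (neg_ne_zero.2 (by norm_num))) : weilNormResidueGroup 3) =
      QuotientGroup.mk (Units.mk0 (-(5 : ℚ)) (neg_ne_zero.2 (by norm_num))) :=
  mk_neg_eq_mk_neg_of_mul_mem (by norm_num) (by norm_num)
    (mem_normUnitsSubgroup_of_sq_add_mul_sq _ (256 : ℚ) (0 : ℚ) (by norm_num))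

/-- `C₃ × F₂₀` (`F₂₀ = AGL(1,5)` on 5 points)-cover `(0; c0:22,c2:22,c2:4A,c2:4B)` (genus 36, Hurwitz dimension 1; engine `prodwin.py`, exact): the HIDDEN FACTOR `B = V^{H₁×Stab(0)}` of the `(λ⊗ρ)`-piece `P ~ B^{4}` (census row of `P`: `W24.3.1`) — an abelian SIXFOLD with `(3,3)` `ℚ(√-3)`-action, WEIL TYPE — has literal `det H|_B = -65536/375`, `a = 65536/375`, `T(a) = [3, 5]`: row `W6.3.5` (NON-split); `r₁ = dim_K H¹(C̃/G₂)_λ = 1`. THEOREM S6 (product-window law, census b04.13 (A)) predicts `T(a_B) = [3, 5]` from `r₁ = 1`, `r_H = 7` — CONFIRMED.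
research route conditional on HC_CM; not a corollary; Q11.4-sentence-2 already refuted in dim ≥ 3. [cite: vanGeemen1994HodgeAV, (5.4.1)] -/
theorem pwC3F20_c022_c222_c24A_c24B_q0_g36_mk_detH_ne_split :
    (QuotientGroup.mk (Units.mk0 (((-65536 : ℚ) / 375)) (by norm_num)) : weilNormResidueGroup 3) ≠
      splitDiscriminantClass 3 3 := by
  have e : Units.mk0 (((-65536 : ℚ) / 375)) (by norm_num) = -(Units.mk0 ((65536 : ℚ) / 375) (by norm_num)) := Units.ext (by norm_num)
  rw [Ne, e, mk_neg_eq_splitDiscriminantClass_iff_of_odd (n := 3) (by decide)]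
  have h := mul_not_mem_normUnitsSubgroup (mem_normUnitsSubgroup_of_sq_add_mul_sq (d := 3) (a := ((65536 : ℚ) / 1875)) (by norm_num) (0 : ℚ) ((256 : ℚ) / 75) (by norm_num))
    Summit.HodgeConjecture.Ring2WeilNormDescent.five_not_mem_norm_three
  rw [mk0_mul_mk0] at h
  norm_num at h
  exact h

/-- The same datum, CELL IDENTIFICATION: `[det H|_B] = [-5]` in `ℚˣ/Nm(ℚ(√-3)ˣ)` — the census ROW KEY of `W6.3.5` (`a·5 = ((65536 : ℚ) / 75) = ((0 : ℚ))² + 3·(((256 : ℚ) / 15))²`).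
research route conditional on HC_CM; not a corollary; Q11.4-sentence-2 already refuted in dim ≥ 3. [cite: vanGeemen1994HodgeAV, Lemma 5.2 (3)] -/
theorem pwC3F20_c022_c222_c24A_c24B_q0_g36_mk_detH_eq_key :
    (QuotientGroup.mk (Units.mk0 (-(((65536 : ℚ) / 375))) (neg_ne_zero.2 (by norm_num))) : weilNormResidueGroup 3) =
      QuotientGroup.mk (Units.mk0 (-(5 : ℚ)) (neg_ne_zero.2 (by norm_num))) :=
  mk_neg_eq_mk_neg_of_mul_mem (by norm_num) (by norm_num)
    (mem_normUnitsSubgroup_of_sq_add_mul_sq _ (0 : ℚ) ((256 : ℚ) / 15) (by norm_num))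

/-- `C₃ × F₂₀` (`F₂₀ = AGL(1,5)` on 5 points)-cover `(0; c1:22,c1:4B,c1:4B)` (genus 21, Hurwitz dimension 0; engine `prodwin.py`, exact): the HIDDEN FACTOR `B = V^{H₁×Stab(0)}` of the `(λ⊗ρ)`-piece `P ~ B^{4}` (census row of `P`: `W16.3.1`) — an abelian FOURFOLD with `(2,2)` `ℚ(√-3)`-action, WEIL TYPE — has literal `det H|_B = 1024/5`, `a = 1024/5`, `T(a) = [3, 5]`: row `W4.3.5` (NON-split); `r₁ = dim_K H¹(C̃/G₂)_λ = 1`. THEOREM S6 (product-window law, census b04.13 (A)) predicts `T(a_B) = [3, 5]` from `r₁ = 1`, `r_H = 5` — CONFIRMED.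
research route conditional on HC_CM; not a corollary; Q11.4-sentence-2 already refuted in dim ≥ 3. [cite: vanGeemen1994HodgeAV, (5.4.1)] -/
theorem pwC3F20_c122_c14B_c14B_q0_g21_mk_detH_ne_split :
    (QuotientGroup.mk (Units.mk0 (((1024 : ℚ) / 5)) (by norm_num)) : weilNormResidueGroup 3) ≠
      splitDiscriminantClass 2 3 := by
  have e : Units.mk0 (((1024 : ℚ) / 5)) (by norm_num) = Units.mk0 ((1024 : ℚ) / 5) (by norm_num) := Units.ext (by norm_num)
  rw [Ne, e, mk_eq_splitDiscriminantClass_iff_of_even (n := 2) (by decide)]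
  have h := mul_not_mem_normUnitsSubgroup (mem_normUnitsSubgroup_of_sq_add_mul_sq (d := 3) (a := ((1024 : ℚ) / 25)) (by norm_num) ((32 : ℚ) / 5) (0 : ℚ) (by norm_num))
    Summit.HodgeConjecture.Ring2WeilNormDescent.five_not_mem_norm_three
  rw [mk0_mul_mk0] at h
  norm_num at h
  exact h

/-- The same datum, CELL IDENTIFICATION: `[det H|_B] = [5]` in `ℚˣ/Nm(ℚ(√-3)ˣ)` — the census ROW KEY of `W4.3.5` (`a·5 = (1024 : ℚ) = ((32 : ℚ))² + 3·((0 : ℚ))²`).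
research route conditional on HC_CM; not a corollary; Q11.4-sentence-2 already refuted in dim ≥ 3. [cite: vanGeemen1994HodgeAV, Lemma 5.2 (3)] -/
theorem pwC3F20_c122_c14B_c14B_q0_g21_mk_detH_eq_key :
    (QuotientGroup.mk (Units.mk0 (((1024 : ℚ) / 5)) (by norm_num)) : weilNormResidueGroup 3) =
      QuotientGroup.mk (Units.mk0 (5 : ℚ) (by norm_num)) :=
  mk_eq_mk_of_mul_mem (by norm_num) (by norm_num)
    (mem_normUnitsSubgroup_of_sq_add_mul_sq _ (32 : ℚ) (0 : ℚ) (by norm_num))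

/-- `C₃ × F₂₀` (`F₂₀ = AGL(1,5)` on 5 points)-cover `(0; c1:22,c1:4A,c1:4A)` (genus 21, Hurwitz dimension 0; engine `prodwin.py`, exact): the HIDDEN FACTOR `B = V^{H₁×Stab(0)}` of the `(λ⊗ρ)`-piece `P ~ B^{4}` (census row of `P`: `W16.3.1`) — an abelian FOURFOLD with `(2,2)` `ℚ(√-3)`-action, WEIL TYPE — has literal `det H|_B = 1024/5`, `a = 1024/5`, `T(a) = [3, 5]`: row `W4.3.5` (NON-split); `r₁ = dim_K H¹(C̃/G₂)_λ = 1`. THEOREM S6 (product-window law, census b04.13 (A)) predicts `T(a_B) = [3, 5]` from `r₁ = 1`, `r_H = 5` — CONFIRMED.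
research route conditional on HC_CM; not a corollary; Q11.4-sentence-2 already refuted in dim ≥ 3. [cite: vanGeemen1994HodgeAV, (5.4.1)] -/
theorem pwC3F20_c122_c14A_c14A_q0_g21_mk_detH_ne_split :
    (QuotientGroup.mk (Units.mk0 (((1024 : ℚ) / 5)) (by norm_num)) : weilNormResidueGroup 3) ≠
      splitDiscriminantClass 2 3 := by
  have e : Units.mk0 (((1024 : ℚ) / 5)) (by norm_num) = Units.mk0 ((1024 : ℚ) / 5) (by norm_num) := Units.ext (by norm_num)
  rw [Ne, e, mk_eq_splitDiscriminantClass_iff_of_even (n := 2) (by decide)]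
  have h := mul_not_mem_normUnitsSubgroup (mem_normUnitsSubgroup_of_sq_add_mul_sq (d := 3) (a := ((1024 : ℚ) / 25)) (by norm_num) ((32 : ℚ) / 5) (0 : ℚ) (by norm_num))
    Summit.HodgeConjecture.Ring2WeilNormDescent.five_not_mem_norm_three
  rw [mk0_mul_mk0] at h
  norm_num at h
  exact h

/-- The same datum, CELL IDENTIFICATION: `[det H|_B] = [5]` in `ℚˣ/Nm(ℚ(√-3)ˣ)` — the census ROW KEY of `W4.3.5` (`a·5 = (1024 : ℚ) = ((32 : ℚ))² + 3·((0 : ℚ))²`).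
research route conditional on HC_CM; not a corollary; Q11.4-sentence-2 already refuted in dim ≥ 3. [cite: vanGeemen1994HodgeAV, Lemma 5.2 (3)] -/
theorem pwC3F20_c122_c14A_c14A_q0_g21_mk_detH_eq_key :
    (QuotientGroup.mk (Units.mk0 (((1024 : ℚ) / 5)) (by norm_num)) : weilNormResidueGroup 3) =
      QuotientGroup.mk (Units.mk0 (5 : ℚ) (by norm_num)) :=
  mk_eq_mk_of_mul_mem (by norm_num) (by norm_num)
    (mem_normUnitsSubgroup_of_sq_add_mul_sq _ (32 : ℚ) (0 : ℚ) (by norm_num))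

/-- `C₃ × F₂₀` (`F₂₀ = AGL(1,5)` on 5 points)-cover `(0; c1:4A,c1:4B,c1:5)` (genus 24, Hurwitz dimension 0; engine `prodwin.py`, exact): the HIDDEN FACTOR `B = V^{H₁×Stab(0)}` of the `(λ⊗ρ)`-piece `P ~ B^{4}` (census row of `P`: `W16.3.1`) — an abelian FOURFOLD with `(2,2)` `ℚ(√-3)`-action, WEIL TYPE — has literal `det H|_B = 4096/15`, `a = 4096/15`, `T(a) = [3, 5]`: row `W4.3.5` (NON-split); `r₁ = dim_K H¹(C̃/G₂)_λ = 1`. THEOREM S6 (product-window law, census b04.13 (A)) predicts `T(a_B) = [3, 5]` from `r₁ = 1`, `r_H = 5` — CONFIRMED.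
research route conditional on HC_CM; not a corollary; Q11.4-sentence-2 already refuted in dim ≥ 3. [cite: vanGeemen1994HodgeAV, (5.4.1)] -/
theorem pwC3F20_c14A_c14B_c15_q0_g24_mk_detH_ne_split :
    (QuotientGroup.mk (Units.mk0 (((4096 : ℚ) / 15)) (by norm_num)) : weilNormResidueGroup 3) ≠
      splitDiscriminantClass 2 3 := by
  have e : Units.mk0 (((4096 : ℚ) / 15)) (by norm_num) = Units.mk0 ((4096 : ℚ) / 15) (by norm_num) := Units.ext (by norm_num)
  rw [Ne, e, mk_eq_splitDiscriminantClass_iff_of_even (n := 2) (by decide)]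
  have h := mul_not_mem_normUnitsSubgroup (mem_normUnitsSubgroup_of_sq_add_mul_sq (d := 3) (a := ((4096 : ℚ) / 75)) (by norm_num) (0 : ℚ) ((64 : ℚ) / 15) (by norm_num))
    Summit.HodgeConjecture.Ring2WeilNormDescent.five_not_mem_norm_three
  rw [mk0_mul_mk0] at h
  norm_num at h
  exact h

/-- The same datum, CELL IDENTIFICATION: `[det H|_B] = [5]` in `ℚˣ/Nm(ℚ(√-3)ˣ)` — the census ROW KEY of `W4.3.5` (`a·5 = ((4096 : ℚ) / 3) = ((0 : ℚ))² + 3·(((64 : ℚ) / 3))²`).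
research route conditional on HC_CM; not a corollary; Q11.4-sentence-2 already refuted in dim ≥ 3. [cite: vanGeemen1994HodgeAV, Lemma 5.2 (3)] -/
theorem pwC3F20_c14A_c14B_c15_q0_g24_mk_detH_eq_key :
    (QuotientGroup.mk (Units.mk0 (((4096 : ℚ) / 15)) (by norm_num)) : weilNormResidueGroup 3) =
      QuotientGroup.mk (Units.mk0 (5 : ℚ) (by norm_num)) :=
  mk_eq_mk_of_mul_mem (by norm_num) (by norm_num)
    (mem_normUnitsSubgroup_of_sq_add_mul_sq _ (0 : ℚ) ((64 : ℚ) / 3) (by norm_num))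

end Summit.HodgeConjecture.HodgeConjecture.Ring2.WeilCoverage
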